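import Literature.NumberTheory.LFunctions.ConreyIwaniec2002Corollary63OfConvexity
import Literature.NumberTheory.LFunctions.DirichletLLogFreeConvexity
import HarnessLib

/-!
# Conrey–Iwaniec (2002), Corollary 6.3 AS TYPED — DISCHARGED

Conrey–Iwaniec, *Spacing of zeros of Hecke L-functions and the class number problem*, Acta Arith.
103 (2002), §6, Corollary 6.3 (6.49) [held text `paper:arxiv-math_0111012` p0016:L154–160]:

> For `Y ≥ 2X ≥ 2` we have `Σ_{X ≤ n ≤ Y} τ²(n,χ) n^{-1} ≪ ℒ(Y) log(Y/X) + (q/X)^{1/2}`,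
> `ℒ(Y) = L(1,χ)(L(1,χ) log Y + |L′(1,χ)|)`.

The typed named fact `conreyIwaniec2002_corollary63` (`ConreyIwaniec2002SpacingMechanism.lean`; one
absolute constant, all `X ≥ 1`, `q > 4`, `χ` primitive quadratic odd) is now a THEOREM:
`conreyIwaniec2002_corollary63_holds`, the composition of the conditional edge
`conreyIwaniec2002_corollary63_of_logFreeConvexity` (majorant `τ² ≤ τ∗τ`, Mellin skeleton on
`re z = −½`, line `majorant-critical-line` of the cell landau-siegel/ls-inputs) with the log-free
convexity bound `DirichletConvexity.dirichletL_logFreeConvexity`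
(`|L(½+it,χ)| ≤ C q^{1/4}(1+|t|)`, smooth approximate functional equation).

«The programme SEARCHES and TYPES; no claim about Landau–Siegel zeros, Theorems 1–2 of
arXiv:2211.02515 or a repaired Margin232 until a kernel theorem says so.»

## References
* [ConreyIwaniec2002] B. Conrey, H. Iwaniec, Acta Arith. 103 (2002) 259–312, Corollary 6.3.
-/

noncomputable section

namespace Literature.NumberTheory.LFunctions

/-- **CONREY–IWANIEC (2002), COROLLARY 6.3, AS TYPED (PROVED).** For `q > 4`, `χ` primitive
quadratic odd mod `q`, `Y ≥ 2X ≥ 2`: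
`Σ_{⌈X⌉ ≤ n ≤ ⌊Y⌋} |τ(n,χ)|²/n ≤ C (ℒ(Y) log(Y/X) + √(q/X))` with one absolute `C`.
[cite: ConreyIwaniec2002, Corollary 6.3 (6.49)] -/
theorem conreyIwaniec2002_corollary63_holds : conreyIwaniec2002_corollary63 :=
  conreyIwaniec2002_corollary63_of_logFreeConvexity DirichletConvexity.dirichletL_logFreeConvexity

end Literature.NumberTheory.LFunctions

end
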